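import Mathlib
import HarnessLib

/-!
# A smooth global extension of `1/x` from the half-line `x ≥ ½`

Analysis/ODE support file (everything proved). `exists_smooth_inv_extension`: there is
`ι ∈ C^∞(ℝ)` with `ι(x) = 1/x` for `x ≥ ½` (hence the Riccati relation `ι' = −ι²` on the open
half-line `x > ½`), together with a smooth primitive `I` (`I' = ι`). Construction:
`ι = χ · x⁻¹` with the smooth step `χ(x) = smoothTransition(4x − 1)` (`= 0` for `x ≤ ¼`, `= 1` for
`x ≥ ½`). This is the coefficient of the global Darboux ladder `(∂ − nι)∘⋯∘(∂ − ι)`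
(`InverseSquareLadder.lean`), which on `x > ½` is the exact intertwining ladder of the inverse-square
potentials `n(n+1)/x²` while keeping every function globally smooth (route PhotonSphereChannels,
`FixedModeChannels`, far side, stmt-FinalStateConjecture-10048). Folklore.
-/

noncomputable section

namespace Literature.Analysis.ODE

open Set Filter Topology

/-- **Smooth extension of `1/x`.** There is a smooth `ι : ℝ → ℝ` with `ι x = x⁻¹` for `x ≥ ½`,
`ι' = −ι²` on `(½, ∞)`, and a smooth primitive `I`, `I' = ι`. [folklore] -/
theorem exists_smooth_inv_extension :
    ∃ ι : ℝ → ℝ, ContDiff ℝ (⊤ : ℕ∞) ι ∧ (∀ x : ℝ, 1 / 2 ≤ x → ι x = x⁻¹) ∧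
      (∀ x ∈ Ioi (1 / 2 : ℝ), deriv ι x = -(ι x) ^ 2) ∧
      ∃ I : ℝ → ℝ, ContDiff ℝ (⊤ : ℕ∞) I ∧ ∀ x, HasDerivAt I (ι x) x := by
  set χ : ℝ → ℝ := fun x => Real.smoothTransition (4 * x - 1) with hχ
  have hχC : ContDiff ℝ (⊤ : ℕ∞) χ :=
    Real.smoothTransition.contDiff.comp ((contDiff_const.mul contDiff_id).sub contDiff_const)
  have hχ0 : ∀ x : ℝ, x ≤ 1 / 4 → χ x = 0 := fun x hx =>
    Real.smoothTransition.zero_of_nonpos (by linarith)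
  have hχ1 : ∀ x : ℝ, 1 / 2 ≤ x → χ x = 1 := fun x hx =>
    Real.smoothTransition.one_of_one_le (by linarith)
  set ι : ℝ → ℝ := fun x => χ x * x⁻¹ with hι
  -- smoothness of `ι`
  have hιC : ContDiff ℝ (⊤ : ℕ∞) ι := by
    refine contDiff_iff_contDiffAt.2 fun x => ?_
    rcases le_or_gt x (1 / 8) with hx | hx
    · -- `ι = 0` near `x`
      have hev : ι =ᶠ[𝓝 x] fun _ => 0 := by
        have : Iio (1 / 4 : ℝ) ∈ 𝓝 x := Iio_mem_nhds (by linarith)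
        refine Filter.mem_of_superset this fun y hy => ?_
        show χ y * y⁻¹ = 0
        rw [hχ0 y (le_of_lt hy), zero_mul]
      exact (contDiffAt_const (c := (0 : ℝ))).congr_of_eventuallyEq hev
    · have hx0 : x ≠ 0 := by positivity
      exact hχC.contDiffAt.mul (contDiffAt_inv ℝ hx0)
  have hιeq : ∀ x : ℝ, 1 / 2 ≤ x → ι x = x⁻¹ := fun x hx => by
    simp only [hι, hχ1 x hx, one_mul]
  have hric : ∀ x ∈ Ioi (1 / 2 : ℝ), deriv ι x = -(ι x) ^ 2 := by
    intro x hx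
    have hx' : (1 / 2 : ℝ) < x := hx
    have hx0 : x ≠ 0 := by positivity
    have hev : ι =ᶠ[𝓝 x] fun y => y⁻¹ :=
      Filter.mem_of_superset (Ioi_mem_nhds hx') fun y hy => hιeq y (le_of_lt hy)
    rw [hev.deriv_eq, deriv_inv, hιeq x hx'.le]
    field_simp
  -- a smooth primitive
  set I : ℝ → ℝ := fun x => ∫ y in (1 : ℝ)..x, ι y with hI
  have hιc : Continuous ι := hιC.continuous
  have hId : ∀ x, HasDerivAt I (ι x) x := fun x =>
    intervalIntegral.integral_hasDerivAt_right (hιc.intervalIntegrable _ _)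
      (hιc.stronglyMeasurableAtFilter _ _) hιc.continuousAt
  have hIC : ContDiff ℝ (⊤ : ℕ∞) I := by
    rw [contDiff_infty_iff_deriv]
    refine ⟨fun x => (hId x).differentiableAt, ?_⟩
    have : deriv I = ι := funext fun x => (hId x).deriv
    rw [this]; exact hιC
  exact ⟨ι, hιC, hιeq, hric, I, hIC, hId⟩

end Literature.Analysis.ODE
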